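import Mathlib
import HarnessLib
import HarnessLib.Audit
import Summits.QuantumFields.Statement
import Summits.QuantumFields.YangMills.Theorems.WeakCouplingRates
import Summits.QuantumFields.YangMills.Theorems.WeakCouplingRatesCurvatureCorrPowerFloor
import HarnessLib.Audit.Status.Attr

/-!
Route: ColdBoxAllGroups

CLOSED (proved) 2026-08-28T17:01:49Z by planner-ym-idea-2-g7-0 — reason: proved:Summit.QuantumFields.YangMills.Theorems.WeakCouplingRates.xiPow_holds — note: opener (ym-idea-2 g7): all four items CLOSED·proved (22254 BoxFloorAllGroups_proof p585759, 22255 BulkAllGroups_proof p592619, 22256 assembly_proof, 22893); rung leaf R2xi-G XiPow proved by xiPow_holds p592925 (LEAD ym-line-cbag-p1 g5, 2026-08-28T01:18Z). D-0145 LINE 1 closed on target. No summit St. The file is kept as the record of this route; refuted decls are indexed as negative knowledge (`ledger negatives`).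

# Route ColdBoxAllGroups — cold-box Gaussian floor + bulk transfer for every compact simple G gives
ξ ≥ β^ε (rung leaf XiPow)

X = BOX_G ∧ BULK_G ("it suffices to show"), a LINE on the rung leaf `WeakCouplingRates.XiPow`
(LADDER-YM R2ξ′: for EVERY compact simple
gauge group G and every faithful unitary lattice representation r, the 4-D Wilson lattice theory has
correlation length ξ ≥ β^ε for SOME
ε > 0; the SU(2)/fundamental instance `XiPowSU2` is already a tree theorem `xiPowSU2_holds`). BOX_G:
for every (G, r) there is an exponent
ceiling θ₀ > 0 such that for all 0 < A < θ < θ₀ the flat-wall axial-gauge box of side 2⌈β^θ⌉+1 has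
β²·(plaquette covariance at time
separation ⌈β^A⌉) ≥ c·C(⌈β^A⌉)² for large β. BULK_G: under every ceiling θ₀ there are admissible A <
θ ≤ θ₀ at which the torus-limit
covariance dominates η × the box covariance. With the tree's group-free FLOOR κ/n⁴ ≤ |C(n)|
(`curvatureCorrPowerFloor_proof`) and the
generic kernel glue `massGapPowerDecayOf_of_box` this yields `XiPow`. No card is realised (ideator
seat D-0145); no summit is proved by
this line — `XiPow` is a rung leaf strictly below the Clay statement.
Lean: `Summit.QuantumFields.YangMills.Theses.ColdBoxAllGroups.BoxFloorAllGroups ∧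
Summit.QuantumFields.YangMills.Theses.ColdBoxAllGroups.BulkAllGroups`

## Assembly
Pure logic plus two tree theorems: given G, hG, r, take θ₀ from BoxFloorAllGroups, exponents (A, θ)
from BulkAllGroups under that ceiling,
c from BoxFloorAllGroups at (A, θ); `massGapPowerDecayOf_of_box r.ρ r.continuous hA hc hbox hbulk
curvatureCorrPowerFloor_proof` gives
`MassGapPowerDecayOf 4 r.ρ (A/2)`, hence `XiPow` with ε = A/2. Kernel-checked as `closes` in
glue.lean (rc 0, no sorry). The deciding theorem
concludes the rung leaf `Summit.QuantumFields.YangMills.Theorems.WeakCouplingRates.XiPow` BY NAME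
(rung shape: DRAFT vs the summit until the
alt-closer R2ξ′ is loaded; then `route edit --closes-target …XiPow`).

CLOSES_TARGET: closes rung R2xi of QuantumFields: Summit.QuantumFields.YangMills.Theorems.WeakCouplingRates.XiPow (D-0061; not the summit Statement) — the deciding theorem of this route concludes that registered leaf instead of the Statement decl `YangMills` (class rung: servable and labelled, never counted as concluding the summit Statement).

Rationale: WHY THIS LINE. The SU(2) weak-coupling-rates engine is now PROVED end to end in the tree
(`ColdBoxTwoPointFloorW_proof` p480280: one-scale Laplace/Gaussian
domination of the axial-gauge cold box, after BrydgesFrohlichSeiler1979 / Chatterjee2016;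
`BulkDominatesColdBoxW_proof` p490223: DLR
disintegration + chessboard large-field rarity, after FrohlichIsraelLiebSimon1978; glue
`massGapPowerDecayOf_of_box` generic in G), but the
live rung `XiPow` quantifies over every compact simple G with `IsCompactSimpleLieGroup G :=
IsSimpleCompactGroup G ∧ Nonempty (LatticeRep G)`
— no smooth structure is given, only a faithful continuous unitary matrix representation. The Lie
theory of the compact LINEAR group r(G) ≤ U(N)
is ALREADY in the tree with soft constants: `FreeEnergyLogCoefficient.expChart / lieIso / dimE` and
`stub_expChartPackage` (exponential chart,
Haar-vs-Lebesgue comparison with a soft constant cH per link, small-ball bound; Chatterjee2016 Thm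
11.1 port used by the all-G proofs
`freeEnergyLogCoefficient_proof` and `massGapVanishesOf_allSimpleG` = rung XI-DIV). The line's one
new input is the SECOND-ORDER version of that
package (Haar Jacobian 1 + O(|a|²) and BCH to second order in the chart, dim G-uniform) — soft
cH^{#links} factors suffice for free-energy leading
terms but not for a covariance LOWER bound — after which the two proved SU(2) mechanisms re-run
uniformly in (G, r): the Gaussian constant
becomes (dim G)/2 (the representation index cancels between action and observable), the large-field
threshold uses faithfulness + compactness.
What it does that listed routes do not: WeakCouplingRates / XiCompleteMonotonicity /
EquipartitionCriticality are SU(2)-only or closed; the two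
other R2ξ′ lines announced tonight (ym-idea-3 «SteinRateEquipartition», ym-idea-5
«SoftLoopVariational») avoid the cold-box expansion — this
line is the engine port, the baseline they must beat; negatives index: no refuted statement touches
box/bulk covariances (checked 20:31Z).

RANKED CRUXES. #2 BoxFloorAllGroups (crux) — for every compact simple G (tree sense) and every
faithful unitary lattice representation r there is θ₀ > 0 such that for all 0 < A < θ ≤ θ₀ some c >
0 satisfies `BoxTwoPointDomination r.ρ A θ c` (β²·boxPlaqCov at separation ⌈β^A⌉ in the box of
half-side ⌈β^θ⌉ ≥ c·curvaturePlaquetteCorr(⌈β^A⌉)² for large β); SU(2)/fundamental instance = proved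
`ColdBoxTwoPointFloorW`. [difficulty: XL] (why it might fail: the tree's chart package
(`stub_expChartPackage`) has only SOFT Haar constants cH^{#links} — useless for a covariance lower
bound; needs the second-order Jacobian/BCH expansion in `expChart`, dim G-uniform, inside the
one-scale Laplace error β^{cθ−1}.) [BrydgesFrohlichSeiler1979, Chatterjee2016, vonNeumann1929,
Sepanski2007]
#3 BulkAllGroups (crux) — for every compact simple G and every r, under every ceiling θ₀ > 0 there
are exponents 0 < A < θ ≤ θ₀ with `BulkDominatesBox r.ρ A θ` (∃ η > 0: torus-limit plaquette
covariance at separation ⌈β^A⌉ ≥ η·box covariance, eventually in the volume L, for large β); SU(2)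
instance = proved `BulkDominatesColdBoxW` (DLR disintegration over the box, chessboard large-field
rarity of the collar, good-boundary covariance stability). [difficulty: XL] (why it might fail:
good-boundary covariance stability for general G needs kernel/mean expansions around non-flat small
boundary data in G-charts (BCH to 2nd order, dim G-uniform constants); chessboard rarity needs a
G-uniform plaquette large-deviation (Haar small-ball) input.) [FrohlichIsraelLiebSimon1978,
DriesslerLandauPerez1979, Balaban1985Averaging, Seiler1982]

TWO-LAYER PLAN. Foreseen glued splits (not filed now): BoxFloorAllGroups ⇐ LinearGroupChart →
BoxGaussianDominationG → BoxFloorAllGroups, where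
LinearGroupChart = the SECOND-ORDER upgrade of the tree's
`FreeEnergyLogCoefficient.stub_expChartPackage` for `expChart r.ρ`: Haar = (1 + O(|a|²))·Lebesgue
on chart balls, a·|a|² ≤ N − Re tr r(expChart a) ≤ b·|a|², and N − Re tr r ≥ κ off the chart ball
(pure Lie theory of r(G) ≤ U(N)) and BoxGaussianDominationG =
the SU(2) stub S3c with ¾ replaced by an ∃ κ > 0 (β²·boxPlaqCov within κ/4·boxCircSqCov of
κ·boxCircSqCov), composed with the tree's group-free
S4 `boxKernelVsLattice`/Wick identity. BulkAllGroups ⇐ LinearGroupChart → GoodBoundaryCovStableG →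
BulkAllGroups, reusing the group-free DLR /
chessboard skeleton of line `dlr-chessboard` (stub_largeFieldRarity p445862, stub_dlrAssembly
p448414 are SU(2)-typed; their G-versions are the children).

KILL CRITERIA. A refutation of BoxFloorAllGroups for some (G, r) (e.g. a compact simple G whose
cold-box covariance at separation β^A is o(β⁻²C²) for every
θ-window) closes the route `refuted:BoxFloorAllGroups`; a proof that BulkDominatesBox fails for
every admissible (A, θ) under small ceilings for
some G forces a pivot to a DLR-free transfer (ym-idea-5's exterior-monotonicity) or retirement. If
`XiPow` is proved by another R2ξ′ line
(SteinRateEquipartition / SoftLoopVariational) the route is moot (`superseded`).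

NOT DECOMPOSED YET. The Lie-theoretic chart package (one child shared by both cruxes), the dim
G-dependent Gaussian constant, the G-uniform plaquette
large-deviation input for chessboard rarity, and the representation-independence (T_r cancellation)
lemma are layer-2 children; constants
(θ₀ as a function of the Laplace error exponent, η) are left to the provers exactly as in the SU(2)
births.

CHEAPEST FALSIFIER. G = SU(3), r = fundamental (dim G = 8): redo the SU(2) one-scale power count of
`ColdBoxTwoPointFloorW` — Laplace remainder ∝ (number of links)²·β⁻¹
= β^{8θ}·… vs signal β⁻²·⌈β^A⌉⁻⁸ — with the 𝔰𝔲(3) chart: if no θ₀ > 0 leaves the remainder below the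
signal the line is dead for SU(3) already.
By hand the count is group-independent (only dim G enters constants, not exponents), so it passes;
instrument row: I3-type certified Gaussian
box two-point for SU(3) at (θ, A) = (0.05, 0.02), β = 10³ (kit, not run tonight).

NUMBERS. SU(2) of record: θ₀ = 1/20 admissible in BOX_W births (Laplace error β^{20θ−1}); Gaussian
constant ¾·boxCircSqCov = (dim G/2)·boxMaxwellPlaqCov²
with dim SU(2) = 3 (Wick: boxCircSqCov = 2·boxMaxwell²); general G: (dim G)/2. Floor: κ/n⁴ ≤ |C(n)|
(curvatureCorrPowerFloor_proof, p451030).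

DEFINITION REQUESTS. None: the chart objects exist
(`Summit.QuantumFields.YangMills.Theorems.FreeEnergyLogCoefficient.expChart`, `dimE`, `lieIso`,
`Literature.MathematicalPhysics.QuantumLattice.RepLieAlgebra`); the second-order package is a
support statement a prover files with `--supports BoxFloorAllGroups`.

Novelty: Searches (2026-08-27): `ledger route closers --problem QuantumFields` (9 leaves; XiPow unregistered,
asked as R2ξ′ by ym-idea-3/ -5); tree `rg XiPow` (only
`xiPowSU2_of_xiPow`, no route targets XiPow); tree `rg expChart|massGapVanishesOf_allSimpleG` (all-G
chart package + XI-DIV found, cited as support); lit search "lattice gauge weak coupling gaussian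
approximation compact Lie group axial gauge" (Chatterjee2016,
BrydgesFrohlichSeiler1979 held); lit frontier QuantumFields --since 2024 (rate-limited, 0 rows);
galaxy "axial gauge|spin wave lattice gauge" (0 usable).
Nearest prior art found: Chatterjee2016 (arXiv:1602.01222: leading free-energy term via axial-gauge
Gaussian approximation, general compact G ⊂ U(N));
in tree route-QuantumFields-WeakCouplingRates (SU(2) only, proved).
Delta: the proved SU(2) cold-box floor + DLR/chessboard bulk transfer re-typed uniformly over
`IsCompactSimpleLieGroup` with the Lie-chart package as
the one new input — a port, honestly graded.
Claimed grade: variant  [refs: 1602.01222, Chatterjee2016, BrydgesFrohlichSeiler1979]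

Barriers (technique_class: gaussian-domination, dlr-chessboard, lie-charts): - technique_class: gaussian-domination, dlr-chessboard, lie-charts
- Literature.Barriers.QuantumFields.PerturbativeInvisibility: outside — the cruxes are LOWER bounds
on a covariance at polynomial separation, exactly what perturbation theory sees; no claim about the
non-perturbative mass.
- Literature.Barriers.QuantumFields.UVStabilityNonUniqueness: BulkAllGroups sits inside its class
(comparison of finite-volume states); evaded as in the SU(2) proof by ONE-scale DLR over a
polynomial box with chessboard rarity, never a multi-scale stability claim.
- Literature.Barriers.QuantumFields.ToronPlaneAnticorrelation: does not bite — flat-wall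
(axial-gauge, boundary links = 1) boxes have no torons; the torus enters only through BULK's DLR
average.
- Negatives index: empty for box/bulk/XiPow statements at filing (ledger negatives --problem
QuantumFields, 2026-08-27T20:31Z). (Not catalogued as barrier decls but checked: discrete-subgroup
freezing does not apply — G continuous, connected; the unitary Haar small-ball bound is used as a
resource for chessboard rarity, thresholds β^{-1+δ} inside its regime.)

History (route lifecycle, newest last):
- 2026-08-27T21:14:10Z · closes_target -> closes rung R2xi-G of QuantumFields: Summit.QuantumFields.YangMills.Theorems.WeakCouplingRates.XiPow (D-0061; not the summit Statement) (planner-ym-idea-2-g0-0)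
- 2026-08-27T21:51:47Z · closes_target -> closes rung R2xi of QuantumFields: Summit.QuantumFields.YangMills.Theorems.WeakCouplingRates.XiPow (D-0061; not the summit Statement) (planner-ym-idea-2-g0-0)
- 2026-08-28T17:01:51Z · CLOSED proved — proved:Summit.QuantumFields.YangMills.Theorems.WeakCouplingRates.xiPow_holds (planner-ym-idea-2-g7-0)

sub-problem: YangMills · status: closed(proved) · opened planner-ym-idea-2-g0-0 2026-08-27T20:38:27Z · rev 2 · ledger route-QuantumFields-ColdBoxAllGroups
GENERATED by the gate from the ledger (D-0016/17). Provers cite these decls: `theorem foo : Summit.QuantumFields.YangMills.Theses.ColdBoxAllGroups.<Decl> := …` in Summits/QuantumFields/YangMills/Theorems/<Name>.lean.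
-/

namespace Summit.QuantumFields.YangMills.Theses.ColdBoxAllGroups

open scoped BigOperators Topology Manifold Classical MeasureTheory ProbabilityTheory Matrix InnerProductSpace ComplexConjugate ContinuousMap
open Filter Set Function TopologicalSpace MeasureTheory

attribute [summit_statement] _root_.YangMills
attribute [summit_statement] _root_.Summit.QuantumFields.YangMills.Theorems.WeakCouplingRates.XiPow

/-- item stmt-QuantumFields-22254 · crux · rank 2 · closed · proved by Summit.QuantumFields.YangMills.Theorems.ColdBoxAllGroups.BoxFloorAllGroups_proof (prover) · by planner
why it might fail: the tree's chart package (`stub_expChartPackage`) has only SOFT Haar constants cH^{#links} — useless for a covariance lower bound; needs the second-order Jacobian/BCH expansion in `expChart`, dim G-uniform, inside the one-scale Laplace error β^{cθ−1}.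
sources: BrydgesFrohlichSeiler1979, Chatterjee2016, vonNeumann1929, Sepanski2007
[crux] for every compact simple G (tree sense) and every faithful unitary lattice representation r
there is θ₀ > 0 such that for all 0 < A < θ ≤ θ₀ some c > 0 satisfies `BoxTwoPointDomination r.ρ A θ
c` (β²·boxPlaqCov at separation ⌈β^A⌉ in the box of half-side ⌈β^θ⌉ ≥
c·curvaturePlaquetteCorr(⌈β^A⌉)² for large β); SU(2)/fundamental instance = proved
`ColdBoxTwoPointFloorW`. [difficulty: XL] -/
@[route_item "route-QuantumFields-ColdBoxAllGroups", crux]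
def BoxFloorAllGroups : Prop :=
  ∀ (G : Type) [Group G] [TopologicalSpace G] [IsTopologicalGroup G] [CompactSpace G], Literature.MathematicalPhysics.QuantumFieldTheory.IsCompactSimpleLieGroup G → letI : MeasurableSpace G := borel G; haveI : BorelSpace G := ⟨rfl⟩; ∀ r : Literature.MathematicalPhysics.QuantumFieldTheory.LatticeRep G, ∃ θ₀ : ℝ, 0 < θ₀ ∧ ∀ A θ : ℝ, 0 < A → A < θ → θ ≤ θ₀ → ∃ c : ℝ, 0 < c ∧ Summit.QuantumFields.YangMills.Theorems.WeakCouplingRates.BoxTwoPointDomination r.ρ A θ c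

-- `BoxFloorAllGroups` holds: proved by `Summit.QuantumFields.YangMills.Theorems.ColdBoxAllGroups.BoxFloorAllGroups_proof` (its module imports this route file, so no `_holds` link can be stated here).

/-- item stmt-QuantumFields-22255 · crux · rank 3 · closed · proved by Summit.QuantumFields.YangMills.Theorems.ColdBoxAllGroups.BulkAllGroups_proof (prover) · by planner
why it might fail: good-boundary covariance stability for general G needs kernel/mean expansions around non-flat small boundary data in G-charts (BCH to 2nd order, dim G-uniform constants); chessboard rarity needs a G-uniform plaquette large-deviation (Haar small-ball) input.
sources: FrohlichIsraelLiebSimon1978, DriesslerLandauPerez1979, Balaban1985Averaging, Seiler1982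
[crux] for every compact simple G and every r, under every ceiling θ₀ > 0 there are exponents 0 < A
< θ ≤ θ₀ with `BulkDominatesBox r.ρ A θ` (∃ η > 0: torus-limit plaquette covariance at separation
⌈β^A⌉ ≥ η·box covariance, eventually in the volume L, for large β); SU(2) instance = proved
`BulkDominatesColdBoxW` (DLR disintegration over the box, chessboard large-field rarity of the
collar, good-boundary covariance stability). [difficulty: XL] -/
@[route_item "route-QuantumFields-ColdBoxAllGroups", crux]
def BulkAllGroups : Prop :=
  ∀ (G : Type) [Group G] [TopologicalSpace G] [IsTopologicalGroup G] [CompactSpace G], Literature.MathematicalPhysics.QuantumFieldTheory.IsCompactSimpleLieGroup G → letI : MeasurableSpace G := borel G; haveI : BorelSpace G := ⟨rfl⟩; ∀ r : Literature.MathematicalPhysics.QuantumFieldTheory.LatticeRep G, ∀ θ₀ : ℝ, 0 < θ₀ → ∃ A θ : ℝ, 0 < A ∧ A < θ ∧ θ ≤ θ₀ ∧ Summit.QuantumFields.YangMills.Theorems.WeakCouplingRates.BulkDominatesBox r.ρ A θ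

-- `BulkAllGroups` holds: proved by `Summit.QuantumFields.YangMills.Theorems.ColdBoxAllGroups.BulkAllGroups_proof` (its module imports this route file, so no `_holds` link can be stated here).

/-- item stmt-QuantumFields-22256 · crux (kind.auto-crux: conjecture-grade) · rank 1 · closed · proved by Summit.QuantumFields.YangMills.Theorems.ColdBoxAllGroups.assembly_proof (prover) · by planner
why it might fail: auto-crux — conjecture-grade statement (statement references the registered conjecture Summit.QuantumFields.YangMills.Theorems.WeakCouplingRates.XiPow); it is open, so it may simply be false
sources: BrydgesFrohlichSeiler1979, FrohlichIsraelLiebSimon1978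
[assembly] BoxFloorAllGroups → BulkAllGroups → the rung leaf XiPow (the deciding theorem `closes` in
glue.lean is this implication, proved). -/
@[route_item "route-QuantumFields-ColdBoxAllGroups"]
def Assembly : Prop :=
  Summit.QuantumFields.YangMills.Theses.ColdBoxAllGroups.BoxFloorAllGroups → Summit.QuantumFields.YangMills.Theses.ColdBoxAllGroups.BulkAllGroups → Summit.QuantumFields.YangMills.Theorems.WeakCouplingRates.XiPow

-- `Assembly` holds: proved by `Summit.QuantumFields.YangMills.Theorems.ColdBoxAllGroups.assembly_proof` (its module imports this route file, so no `_holds` link can be stated here).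

/-- item stmt-QuantumFields-22893 · support · rank 9 · closed · proved by Summit.QuantumFields.YangMills.Theorems.ColdBoxAllGroups.stub_expChartPackage2 (prover) · by planner
[support] second-order exponential chart package for a faithful unitary representation ρ : G →* U(N)
of a compact group (uniform in nothing but ρ): (a) two-sided quadratic plaquette cost |N − Re tr
ρ(exp a) − |a|²/2| ≤ C₂|a|⁴ on the chart ball r₂, (b) Baker–Campbell–Hausdorff to second order in
the chart with cubic remainder and ‖c‖ ≤ 2(‖a‖+‖b‖), (c) Haar = c_H·J·Lebesgue on chart balls with
|J − 1| ≤ C₂|a|². Shared stub of crux BoxFloorAllGroups (critic idea-crit-4 P3: file first,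
--supports BoxFloorAllGroups) and of ym-idea-5 AllGroupsColdBox; soft version stub_expChartPackage
is landed (Theorems/…StubExpChartPackage.lean). Why it might fail: routine Lie theory, only the
dimE/Frobenius normalisations can be mis-set. Sources: Sepanski2007 (Compact Lie Groups) Thm 4.6 +
§1.3 Haar in exponential coordinates; vonNeumann1929; arXiv:1602.01222 §11. -/
@[route_item "route-QuantumFields-ColdBoxAllGroups"]
def ExpChartPackage2 : Prop :=
  ∀ (N : ℕ) (G : Type) [Group G] [TopologicalSpace G] [IsTopologicalGroup G] [CompactSpace G] [MeasurableSpace G] [BorelSpace G] (ρ : G →* Matrix (Fin N) (Fin N) ℂ), Continuous ρ → Function.Injective ρ → (∀ g, ρ g ∈ Matrix.unitaryGroup (Fin N) ℂ) → ∃ (r₂ C₂ cH : ℝ), 0 < r₂ ∧ 0 < C₂ ∧ 0 < cH ∧ (∀ a : EuclideanSpace ℝ (Fin (Summit.QuantumFields.YangMills.Theorems.FreeEnergyLogCoefficient.dimE ρ)), ‖a‖ ≤ r₂ → |((N : ℝ) - (Matrix.trace (ρ (Summit.QuantumFields.YangMills.Theorems.FreeEnergyLogCoefficient.expChart ρ a))).re)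 - ‖a‖ ^ 2 / 2| ≤ C₂ * ‖a‖ ^ 4) ∧ (∀ a b : EuclideanSpace ℝ (Fin (Summit.QuantumFields.YangMills.Theorems.FreeEnergyLogCoefficient.dimE ρ)), ‖a‖ ≤ r₂ → ‖b‖ ≤ r₂ → ∃ c : EuclideanSpace ℝ (Fin (Summit.QuantumFields.YangMills.Theorems.FreeEnergyLogCoefficient.dimE ρ)), Summit.QuantumFields.YangMills.Theorems.FreeEnergyLogCoefficient.expChart ρ a * Summit.QuantumFields.YangMills.Theorems.FreeEnergyLogCoefficient.expChart ρ b = Summit.QuantumFields.YangMills.Theorems.FreeEnergyLogCoefficient.expChart ρ c ∧ ‖c‖ ≤ 2 * (‖a‖ + ‖b‖) ∧ @norm _ Matrix.frobeniusSeminormedAddCommGroup.toNorm (Summit.QuantumFields.YangMills.Theorems.FreeEnergyLogCoefficient.lieIso ρ c - (Summit.QuantumFields.YangMills.Theorems.FreeEnergyLogCoefficient.lieIso ρ a + Summit.QuantumFields.YangMills.Theorems.FreeEnergyLogCoefficient.lieIso ρ b + (1 / 2 : ℝ) • (Summit.QuantumFields.YangMills.Theorems.FreeEnergyLogCoefficient.lieIso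 ρ a * Summit.QuantumFields.YangMills.Theorems.FreeEnergyLogCoefficient.lieIso ρ b - Summit.QuantumFields.YangMills.Theorems.FreeEnergyLogCoefficient.lieIso ρ b * Summit.QuantumFields.YangMills.Theorems.FreeEnergyLogCoefficient.lieIso ρ a))) ≤ C₂ * (‖a‖ + ‖b‖) ^ 3) ∧ (∃ J : EuclideanSpace ℝ (Fin (Summit.QuantumFields.YangMills.Theorems.FreeEnergyLogCoefficient.dimE ρ)) → ℝ, Continuous J ∧ (∀ a, ‖a‖ ≤ r₂ → |J a - 1| ≤ C₂ * ‖a‖ ^ 2) ∧ ∀ r : ℝ, 0 < r → r ≤ r₂ → ∀ F : G → ENNReal, Measurable F → ∫⁻ g in Summit.QuantumFields.YangMills.Theorems.FreeEnergyLogCoefficient.expChart ρ '' Metric.closedBall 0 r, F g ∂(Literature.MathematicalPhysics.QuantumFieldTheory.haarProbability G) = ENNReal.ofReal cH * ∫⁻ a in Metric.closedBall (0 : EuclideanSpace ℝ (Fin (Summit.QuantumFields.YangMills.Theorems.FreeEnergyLogCoefficient.dimE ρ))) r, F (Summit.QuantumFields.YangMills.Theorems.FreeEnergyLogCoefficient.expChart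 ρ a) * ENNReal.ofReal (J a))

-- `ExpChartPackage2` holds: proved by `Summit.QuantumFields.YangMills.Theorems.ColdBoxAllGroups.stub_expChartPackage2` (its module imports this route file, so no `_holds` link can be stated here).

/-! D-0027 §2.1 — DECIDING THEOREM (planner-authored via `route open/edit --closes-file`; by planner-ym-idea-2-g0-0 2026-08-27T21:51:47Z) — ARCHIVED: route closed (proved) 2026-08-28T17:01:49Z; kept so importers keep building:
its hypotheses are this route's items and its conclusion the registered leaf `Summit.QuantumFields.YangMills.Theorems.WeakCouplingRates.XiPow` (rung R2xi, D-0061) (glue_lint), and it elaborates with this file. -/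

@[closes "route-QuantumFields-ColdBoxAllGroups"] theorem closes (h₁ : BoxFloorAllGroups) (h₂ : BulkAllGroups) :
    Summit.QuantumFields.YangMills.Theorems.WeakCouplingRates.XiPow := by
  intro G _ _ _ _ hG
  letI : MeasurableSpace G := borel G
  haveI : BorelSpace G := ⟨rfl⟩
  show ∀ r : Literature.MathematicalPhysics.QuantumFieldTheory.LatticeRep G, ∃ ε : ℝ, 0 < ε ∧
    Summit.QuantumFields.YangMills.Theorems.WeakCouplingRates.MassGapPowerDecayOf 4 r.ρ ε
  intro r
  have hb : ∀ r : Literature.MathematicalPhysics.QuantumFieldTheory.LatticeRep G, ∃ θ₀ : ℝ, 0 < θ₀ ∧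
      ∀ A θ : ℝ, 0 < A → A < θ → θ ≤ θ₀ → ∃ c : ℝ, 0 < c ∧
        Summit.QuantumFields.YangMills.Theorems.WeakCouplingRates.BoxTwoPointDomination r.ρ A θ c := h₁ G hG
  have hk : ∀ r : Literature.MathematicalPhysics.QuantumFieldTheory.LatticeRep G, ∀ θ₀ : ℝ, 0 < θ₀ →
      ∃ A θ : ℝ, 0 < A ∧ A < θ ∧ θ ≤ θ₀ ∧
        Summit.QuantumFields.YangMills.Theorems.WeakCouplingRates.BulkDominatesBox r.ρ A θ := h₂ G hG
  obtain ⟨θ₀, hθ₀, hbox⟩ := hb r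
  obtain ⟨A, θ, hA, hAθ, hθ, hbulk⟩ := hk r θ₀ hθ₀
  obtain ⟨c, hc, hB⟩ := hbox A θ hA hAθ hθ
  have hF : ∃ κ : ℝ, 0 < κ ∧ ∃ n₀ : ℕ, ∀ n : ℕ, n₀ ≤ n → κ / (n : ℝ) ^ 4 ≤
      |Literature.MathematicalPhysics.QuantumFieldTheory.curvaturePlaquetteCorr (d := 4) (by norm_num) (n : ℤ)| :=
    Summit.QuantumFields.YangMills.Theorems.WeakCouplingRates.curvatureCorrPowerFloor_proof
  exact ⟨A / 2, by linarith,
    Summit.QuantumFields.YangMills.Theorems.WeakCouplingRates.massGapPowerDecayOf_of_box r.ρ r.continuous hA hc hB hbulk hF⟩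

end Summit.QuantumFields.YangMills.Theses.ColdBoxAllGroups
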